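import Summits.BirchSwinnertonDyer.BirchSwinnertonDyer.Theorems.CMKolyvaginAtInertTwoLowerWitnessUpgradeAtTwo
import Summits.BirchSwinnertonDyer.BirchSwinnertonDyer.Theorems.CMKolyvaginAtInertTwoPairSupplyStubUpperAtTwo
import HarnessLib

/-!
# Route `CMKolyvaginAtInertTwo`, crux `CMKolyvaginExactAtInertTwo` (stmt-BirchSwinnertonDyer-24277):
# THE CRUX'S OWN STATEMENT ON H₂ ∩ {|d_K| prime} — `#Ш(E_K)(2) = 2^{2M₀}` — modulo the four published inputs and Gross 1991 Prop. 3.7 (2)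

Seat `bsd-line-cmk2-p1` g19 (cell `bsd-print-cf2`), `--supports stmt-BirchSwinnertonDyer-24277` (helper; closes nothing by name — the
booking of an aside is the pen's call, TURNKEY v2 in `Cruxes/CMExactDescentAtTwo/`).
THEOREMS ONLY (no definition, no named fact, no `sorry`).  BSD is NOT proved by any of this.

`le_antisymm` of the two halves now in the tree: g18's UPPER headline
`KolyvaginPairSupplyTwo.card_primaryComponent_sha_two_baseChange_le_pow_of_printedInputs` (certificate-free; adaptive Cassels–Tate telescope)
and this seat's LOWER `KolyvaginLowerTwo.pow_le_card_primaryComponent_sha_two_baseChange_of_certificate_of_printedInputs` (gk2's LINE 18 KS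
chain ported to H₂ + the all-Gross level-2 swap engine W-UP, files A–D1, W1–W4d).
* `card_primaryComponent_sha_two_baseChange_eq_pow_of_certificate_of_printedInputs`;
* **`cmKolyvaginExactAtInertTwo_of_prime_of_printedInputs`** — crux 24277's signature VERBATIM followed by `Nat.Prime |d_K|`,
  `prop37_2_reductionCongruence_inert N_E W K` and the four prints (items 24148, 19921, 19273, 24149).
Residuals: composite `d_K` (Σ ≥ 2); the named fact (typer task); the prints.  BSD is NOT proved by any of this.

References: [McCallumLMS1991] §5 Thm. 5.4, Thm. 5.8; [Kolyvagin1991MathAnn] Thm. 2.2; [GrossLMS1991] Prop. 3.7 (2); [GrossZagier1986]; [Milne1972].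
-/

set_option autoImplicit false
-- the Theorems namespace of this sub repeats the summit name by design (D-0017 nested layout)
set_option linter.dupNamespace false

noncomputable section

open scoped Classical

open WeierstrassCurve NumberField IsDedekindDomain Field Literature.NumberTheory.EllipticCurves
open Literature.NumberTheory.EllipticCurves.ModularForms
open Literature.NumberTheory.EllipticCurves.GrossLMS1991 (prop37_2_reductionCongruence_inert)
open Summit.BirchSwinnertonDyer.BirchSwinnertonDyer.Theorems.GenusExact
open Summit.BirchSwinnertonDyer.Rank1Residual

namespace Summit.BirchSwinnertonDyer.BirchSwinnertonDyer.Theorems.KolyvaginLowerTwo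

/-- **`#Ш(E_K)(2) = 2^{2M₀}` ON H₂ ∩ {|d_K| prime} FROM THE CRUX'S CERTIFICATE, modulo the four prints + Gross 3.7 (2).**  The crux
frame (CM, `2` inert in the CM field, `ρ̄_{E,2}` onto, odd Tamagawa product; `K` imaginary quadratic, `d_K` odd `≠ −3`, Heegner), `Nat.Prime
|d_K|`, `2^{M₀} ∥ y_K` in `E(K[1])`, and the certificate (`n` square-free of Zhang–Kolyvagin primes at `2` that are CM-inert, `P(n) ∉ 2E(K[n])`):
**`Nat.card (Ш(E_K)(2)) = 2^(2·M₀)`**.  BSD is NOT proved by this. [cite: McCallumLMS1991, §5 Thm. 5.4] [cite: Kolyvagin1991MathAnn, Thm. 2.2]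
[cite: GrossLMS1991, Prop. 3.7 (2)] -/
theorem card_primaryComponent_sha_two_baseChange_eq_pow_of_certificate_of_printedInputs
    (hGZ : ∀ (N : ℕ) [NeZero N] (W : WeierstrassCurve ℚ) (K : Type) [Field K] [NumberField K], gross_zagier N W K)
    (hGZK : rank_eq_analyticRank_of_analyticRank_le_one) (hmod : hasEntireLFunction_rat)
    (hMilneC : Milne1972.bsdQuotient_baseChange_quadratic_anyModel)
    (W : WeierstrassCurve ℚ) [W.IsElliptic] [W.IsGloballyMinimal] [NeZero (W.conductorNorm ℤ)]
    (hCM : W.HasCM) (hin : Rank1Residual.CMInert W 2) (hρ2 : W.HasSurjectiveModNGaloisRep 2)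
    (hT : Odd W.tamagawaProduct) (K : Type) [Field K] [NumberField K] (hIQ : IsImaginaryQuadratic K)
    (hodd : Odd (NumberField.discr K)) (h3 : NumberField.discr K ≠ -3) (hq : (NumberField.discr K).natAbs.Prime)
    (hHe : SatisfiesHeegnerHypothesis (W.conductorNorm ℤ) K)
    (h37 : prop37_2_reductionCongruence_inert (W.conductorNorm ℤ) W K)
    (Dt : ModularParametrizationData W (W.conductorNorm ℤ)) (β : ℤ) (ι : K →+* ℂ) (d₁ : KolyvaginHeegnerData Dt β ι 1)
    (hy : ¬ IsOfFinAddOrder d₁.derivedPoint) (M₀ : ℕ)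
    (hM₀ : ∃ Q : (W.baseChange (ringClassField K ι 1)).toAffine.Point, ((2 ^ M₀ : ℕ) : ℤ) • Q = d₁.derivedPoint)
    (hndiv : ¬ ∃ Q : (W.baseChange (ringClassField K ι 1)).toAffine.Point, ((2 ^ (M₀ + 1) : ℕ) : ℤ) • Q = d₁.derivedPoint)
    {n : ℕ} (d : KolyvaginHeegnerData Dt β ι n) (hn : Squarefree n)
    (hKoly : ∀ ℓ ∈ n.primeFactors, Zhang2014.IsKolyvaginPrime (W.conductorNorm ℤ) W K 2 ℓ ∧ Rank1Residual.CMInert W ℓ)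
    (hPn : ¬ ∃ Q : (W.baseChange (ringClassField K ι n)).toAffine.Point, (2 : ℤ) • Q = d.derivedPoint) :
    Nat.card (AddCommGroup.primaryComponent (W.baseChange K).sha 2) = 2 ^ (2 * M₀) :=
  le_antisymm
    (KolyvaginPairSupplyTwo.card_primaryComponent_sha_two_baseChange_le_pow_of_printedInputs W hGZ hGZK hmod hMilneC hCM hin hρ2 hT hIQ
      hodd h3 hHe hq h37 Dt β ι d₁ hy M₀ hM₀ hndiv)
    (pow_le_card_primaryComponent_sha_two_baseChange_of_certificate_of_printedInputs hGZ hGZK hmod hMilneC W hCM hin hρ2 hT K hIQ hodd h3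
      hq hHe h37 Dt β ι d₁ hy M₀ hM₀ hndiv d hn hKoly hPn)

/-- **Crux 24277's signature VERBATIM, followed by `Nat.Prime |d_K|`, Gross 3.7 (2) by name and the four prints** ⟹ the crux's conclusion
`Nat.card (Ш(E_K)(2)) = 2^(2·M₀)`.  What the route's exactness crux IS on Σ ≤ 1, as a conditional tree theorem.  BSD is NOT proved by this;
nothing is closed by name. [cite: McCallumLMS1991, §5 Thm. 5.4, Thm. 5.8] [cite: GrossLMS1991, Prop. 3.7 (2)] -/
theorem cmKolyvaginExactAtInertTwo_of_prime_of_printedInputs :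
    ∀ (W : WeierstrassCurve ℚ) [W.IsElliptic] [W.IsGloballyMinimal] [NeZero (W.conductorNorm ℤ)], W.HasCM → Literature.NumberTheory.EllipticCurves.Rank1Residual.CMInert W 2 → W.HasSurjectiveModNGaloisRep (2 : ℤ) → Odd W.tamagawaProduct → ∀ (K : Type) [Field K] [NumberField K], Literature.NumberTheory.EllipticCurves.IsImaginaryQuadratic K → Odd (NumberField.discr K) → NumberField.discr K ≠ -3 → Literature.NumberTheory.EllipticCurves.SatisfiesHeegnerHypothesis (W.conductorNorm ℤ) K → ¬ IsSquare ((NumberField.discr K : ℚ) * -|W.Δ|) → ¬ IsSquare ((NumberField.discr K : ℚ) * (-(2 * |W.Δ|))) → ∀ (Dt : Literature.NumberTheory.EllipticCurves.ModularForms.ModularParametrizationData W (W.conductorNorm ℤ)) (β : ℤ) (ι : K →+* ℂ) (d₁ : Literature.NumberTheory.EllipticCurves.KolyvaginHeegnerData Dt β ι 1), ¬ IsOfFinAddOrder d₁.derivedPoint → ∀ (M₀ : ℕ), (∃ Q : (W.baseChange (Literature.NumberTheory.EllipticCurves.ringClassField K ι 1)).toAffine.Point, ((2 ^ M₀ : ℕ)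 : ℤ) • Q = d₁.derivedPoint) → (¬ ∃ Q : (W.baseChange (Literature.NumberTheory.EllipticCurves.ringClassField K ι 1)).toAffine.Point, ((2 ^ (M₀ + 1) : ℕ) : ℤ) • Q = d₁.derivedPoint) → ∀ (n : ℕ) (d : Literature.NumberTheory.EllipticCurves.KolyvaginHeegnerData Dt β ι n), Squarefree n → (∀ ℓ ∈ n.primeFactors, (Literature.NumberTheory.EllipticCurves.Zhang2014.IsKolyvaginPrime (W.conductorNorm ℤ) W K 2 ℓ ∧ Literature.NumberTheory.EllipticCurves.Rank1Residual.CMInert W ℓ)) → (¬ ∃ Q : (W.baseChange (Literature.NumberTheory.EllipticCurves.ringClassField K ι n)).toAffine.Point, (2 : ℤ) • Q = d.derivedPoint) →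
      -- the extra hypotheses
      Nat.Prime (NumberField.discr K).natAbs →
      Literature.NumberTheory.EllipticCurves.GrossLMS1991.prop37_2_reductionCongruence_inert (W.conductorNorm ℤ) W K →
      (∀ (N : ℕ) [NeZero N] (W : WeierstrassCurve ℚ) (K : Type) [Field K] [NumberField K], gross_zagier N W K) →
      rank_eq_analyticRank_of_analyticRank_le_one → hasEntireLFunction_rat → Milne1972.bsdQuotient_baseChange_quadratic_anyModel →
      Nat.card (AddCommGroup.primaryComponent (W.baseChange K).sha 2) = 2 ^ (2 * M₀) := by
  intro W _ _ _ hCM hin hρ hT K _ _ hK hodd h3 hH _ _ Dt β ι d₁ hy M₀ hdiv hndiv n d hn hKoly hPn hq h37 hGZ hGZK hmod hMi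
  exact card_primaryComponent_sha_two_baseChange_eq_pow_of_certificate_of_printedInputs hGZ hGZK hmod hMi W hCM hin hρ hT K hK hodd h3 hq
    hH h37 Dt β ι d₁ hy M₀ hdiv hndiv d hn hKoly hPn

end Summit.BirchSwinnertonDyer.BirchSwinnertonDyer.Theorems.KolyvaginLowerTwo

end
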